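import Literature.NumberTheory.EllipticCurves.EisensteinNewformLevelRaising

/-!
# Billerey–Menares 2016, Thm. 2.2: the odd-prime form implies the form at `p ≥ 5` (proofs only)

Topic `Literature/NumberTheory/EllipticCurves`; namespace `Literature.NumberTheory.EllipticCurves`.
THEOREMS ONLY (no definition, no named fact; D-0026).  A proofs-only companion of the two named
facts of `EisensteinNewformLevelRaising.lean` rendering N. Billerey, R. Menares, *On the modularity
of reducible mod `l` Galois representations*, Math. Res. Lett. 23 (2016) 15–41 (= arXiv:1309.3717),
§2, Thm. 2.2 (p. 7):

* `Literature.NumberTheory.EllipticCurves.BillereyMenares2016_thm22_exists_newform` — the theorem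
  at a prime `p ≥ 5`, the von Staudt clause of its hypotheses being indexed by `k + 1 = p`;
* `Literature.NumberTheory.EllipticCurves.BillereyMenares2016_thm22_exists_newform_odd` — the same
  rendering VERBATIM at every odd prime `p`, the von Staudt clause being indexed by `(p - 1) ∣ k`
  (the printed condition "`ε₀ω^k = 1`", i.e. `(p - 1) ∣ k` and `ε = 1`, under which
  `v_p(B_{k,ε₀}/2k) = -1` has to be compensated by `v_p(M^k - 1) ≥ 2`; Washington, *Introduction to
  Cyclotomic Fields*, Thm. 5.10).

On the Billerey–Menares weights `k ∈ {p, p + 1} ∪ [3, p - 1]` (op. cit. p. 7: `k = l` if `b = 0`,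
`l + 1` if `b = 1`, `b + 1` if `2 ≤ b ≤ l - 2`) and for `p ≥ 5` the two indexings agree —
`(p - 1) ∣ k ↔ k + 1 = p` (`prime_sub_one_dvd_weight_iff`) — so the odd-prime fact is, word for
word, the conjunction of the `p ≥ 5` fact and of its own case `p = 3`; in particular
**`BillereyMenares2016_thm22_exists_newform_odd → BillereyMenares2016_thm22_exists_newform`**
(`BillereyMenares2016_thm22_exists_newform_of_odd`): a discharge of the odd-prime fact discharges
the `p ≥ 5` fact, and every dependent of the latter
(`Summits/Langlands/Langlands/Theorems/SkinnerWilesDefectOneSeedOfQuadraticBaseChange.lean`, …) may be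
fed the former.  (For `p = 3` the weights are `k ∈ {3, 4}` and `(p - 1) ∣ k` singles out
`k = 4 = p + 1`, the case `b = 1`, which the indexing `k + 1 = p` of the `p ≥ 5` rendering would
miss: this is the "ONE reason" for the separate odd-prime fact recorded in
`Summits/Langlands/Langlands/Theorems/SkinnerWilesDefectOneSeedOfQuadraticBaseChangeEisensteinPackageQOdd.lean`.)

## References

* N. Billerey, R. Menares, *On the modularity of reducible mod `l` Galois representations*, Math.
  Res. Lett. 23 (2016), no. 1, 15–41, §2, Thm. 2.2 (p. 7). doi:10.4310/mrl.2016.v23.n1.a2,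
  arXiv:1309.3717. [BillereyMenares2016]
* L. C. Washington, *Introduction to Cyclotomic Fields*, GTM 83 (1997), Thm. 5.10
  (von Staudt–Clausen). [Washington1997]
-/

namespace Literature.NumberTheory.EllipticCurves

/-! ### The von Staudt clause on the Billerey–Menares weights -/

/-- **On the Billerey–Menares weights `k ∈ {p, p + 1} ∪ [3, p - 1]` and for `p ≥ 5`, the von Staudt
condition `(p - 1) ∣ k` singles out the weight `k = p - 1`.**  (For `p ≥ 5`: `p ≡ 1` and
`p + 1 ≡ 2 (mod p - 1)` are non-zero, and `0 < k ≤ p - 1` is a multiple of `p - 1` only if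
`k = p - 1`.)  Billerey–Menares 2016, §2 (p. 7): "`k - 1 ≡ b (mod l - 1)`", with `ε₀ω^k = 1` iff
`b ≡ -1`, i.e. `b = l - 2`, `k = l - 1`. [cite: BillereyMenares2016, §2, Thm. 2.2 (p. 7)] -/
theorem prime_sub_one_dvd_weight_iff {p k : ℕ} (hp : 5 ≤ p)
    (hk : k = p ∨ k = p + 1 ∨ (3 ≤ k ∧ k + 1 ≤ p)) : (p - 1) ∣ k ↔ k + 1 = p := by
  constructor
  · -- `k = (p - 1) c`: `c = 0` gives `k = 0`, `c = 1` gives `k = p - 1`, and `c ≥ 2` gives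
    -- `k ≥ 2p - 2 > p + 1`
    rintro ⟨c, hc⟩
    rcases Nat.lt_or_ge c 2 with hc2 | hc2
    · interval_cases c <;> omega
    · have : (p - 1) * 2 ≤ (p - 1) * c := Nat.mul_le_mul_left _ hc2
      omega
  · intro h
    exact ⟨1, by omega⟩

/-! ### The odd-prime fact implies the fact at `p ≥ 5` -/

/-- **Billerey–Menares 2016, Thm. 2.2: the odd-prime rendering implies the rendering at `p ≥ 5`.**
The two named facts `BillereyMenares2016_thm22_exists_newform_odd` (every odd prime `p`, von Staudt
clause indexed by `(p - 1) ∣ k`) and `BillereyMenares2016_thm22_exists_newform` (`p ≥ 5`, clause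
indexed by `k + 1 = p`) of `EisensteinNewformLevelRaising.lean` coincide verbatim except for these
two spots, and for `p ≥ 5` the clause `k + 1 = p → …` of the latter yields the clause
`(p - 1) ∣ k → …` of the former (`prime_sub_one_dvd_weight_iff`).  Hence a proof of the odd-prime
fact is a proof of the `p ≥ 5` fact. [cite: BillereyMenares2016, §2, Thm. 2.2 (p. 7)] -/
theorem BillereyMenares2016_thm22_exists_newform_of_odd
    (h : BillereyMenares2016_thm22_exists_newform_odd) :
    BillereyMenares2016_thm22_exists_newform := by
  intro p _ hp ι η k M hunit hodd hk hinertia hM hMp hunr hfrob hvs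
  exact h p (by omega) ι η k M hunit hodd hk hinertia hM hMp hunr hfrob
    (fun hdvd ↦ hvs ((prime_sub_one_dvd_weight_iff hp hk).mp hdvd))

/-- The same implication pointwise in the prime: **at a prime `p ≥ 5` the hypotheses of the `p ≥ 5`
rendering imply those of the odd-prime rendering**, so that the odd-prime fact yields the conclusion
of Billerey–Menares, Thm. 2.2 from the hypotheses as phrased in
`BillereyMenares2016_thm22_exists_newform` (useful to feed a dependent of the `p ≥ 5` fact one prime
at a time). [cite: BillereyMenares2016, §2, Thm. 2.2 (p. 7)] -/
theorem BillereyMenares2016_thm22_exists_newform_odd.vonStaudt_clause {p k M : ℕ} (hp : 5 ≤ p)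
    (hk : k = p ∨ k = p + 1 ∨ (3 ≤ k ∧ k + 1 ≤ p)) {A : Prop}
    (hvs : k + 1 = p → A → M ^ (p - 1) % p ^ 2 = 1) :
    (p - 1) ∣ k → A → M ^ (p - 1) % p ^ 2 = 1 :=
  fun hdvd ↦ hvs ((prime_sub_one_dvd_weight_iff hp hk).mp hdvd)

end Literature.NumberTheory.EllipticCurves
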